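import Literature.Topology.FourManifolds.NullCobordismHCobordism
import Literature.AlgebraicTopology.Homotopy.CollarSlab
import Literature.AlgebraicTopology.SingularHomology.AlexanderDualityFacts
import HarnessLib

/-!
# The boundary of a contractible manifold is a homology sphere: Kervaire–Milnor's Lemma 2.3, the duality step, from Alexander duality

Topic `Literature/Topology/FourManifolds`, sibling of `HomotopySpheresInverseHomotopy.lean`,
`NullCobordismBoundaryHomology.lean` and `NullCobordismHCobordism.lean`. The named fact
`Literature.Topology.FourManifolds.NullCobordism.isIso_singularHomology_map_inclToComplCenter`
(M. Kervaire, J. Milnor, *Groups of homotopy spheres I*, Ann. of Math. 77 (1963), proof of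
Lemma 2.3, pp. 506–507: for `M = ∂W'` closed simply connected of dimension `n ≥ 2` with `W'`
compact contractible, and an open disc `i(ℝⁿ⁺¹) ⊆ Int W'`, the map `M → W' ∖ {i 0}` is an
isomorphism on all `Hₖ(-; ℤ)` — "Now applying the Poincaré duality isomorphism
`Hₖ(W, M) ≅ Hⁿ⁺¹⁻ᵏ(W, Sⁿ)`, we see that the inclusion `M → W` also induces isomorphisms of
homology groups") is here REDUCED TO A SINGLE NAMED FACT of the singular homology library,

* `Literature.AlgebraicTopology.SingularHomology.isZero_localHomologyOfSet_of_contractible_nhds ℤ`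
  (`AlexanderDualityFacts.lean`; Miller, *Lectures on Algebraic Topology* (2020), Cor. 37.4 with
  Lemma 34.5 = Spanier, *Algebraic Topology* (1966), Ch. 6 §2 Thm. 17 with §1 Ex. 7: the local
  homology `H_q(X | K; ℤ)` of an oriented `n`-manifold at a compact set with arbitrarily small
  contractible neighbourhoods vanishes for `q ≠ n`),

everything else being proved (`NullCobordism.isIso_singularHomology_map_inclToComplCenter_of_alexander`).

**How.** `NullCobordismHCobordism.lean` proves the conclusion duality-free for boundaries `M`
which are already integral homology spheres (`NullCobordism.isIso_map_inclToComplCenter`: the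
degree-`n` surjectivity `Hₙ(X ∖ K) → Hₙ(X ∖ {i 0})` by the orientation class of the compact core
`K` of the interior `X = Int W'`, `AcyclicPuncture.lean`; the other degrees trivially). For a
general closed simply connected `M = ∂W'` with `W'` contractible, `Hₙ(M; ℤ) ≅ ℤ` (simply
connected ⇒ `ℤ`-orientable, Hatcher Prop. 3.25 and Thm. 3.26(a)) and `Hₖ(M; ℤ) = 0` for `k > n`
(Thm. 3.26(c)) are tree theorems, and the one genuinely dual statement — **`Hₖ(M; ℤ) = 0` for
`1 ≤ k ≤ n - 1`** (`NullCobordism.isZero_singularHomology_of_alexander`) — is Alexander duality: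
`M ≃ κ(M × (0, 1)) ≅ X ∖ K` (collar, `BoundaryCollar.stripHomotopyEquiv`,
`stripHomeomorphInterior`), the compact core `K` has arbitrarily small contractible open
neighbourhoods in `X` (`exists_contractible_nhd_coreInterior`, from `CollarSlab.lean`: the
complements `W' ∖ κ(M × [0, s])` of closed collars), `X` is a simply connected, hence
`ℤ`-oriented, acyclic boundaryless `(n+1)`-manifold, so the fact gives `Hₖ₊₁(X | K) = 0`
(`k + 1 ≠ n + 1`) and the exact sequence of the pair gives `Hₖ(X ∖ K) = 0`. Compared with the
reduction of `NullCobordismBoundaryHomology.lean` (to Spanier's Thm. 6.3.5, Lefschetz duality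
6.3.12 for topological manifolds with boundary, and universal coefficients), this route needs
neither cap products on `W'` nor a fundamental class of `(W', ∂W')`, and the remaining fact is the
target of the tree's duality programme (`CohomologyHomotopyInvariance.lean`,
`CohomologyOfPoint.lean`, …: Čech cohomology, the cap product `Ȟ^p(K) → H_{n-p}(X | K)` and
Miller's proof of Alexander–Poincaré duality), which is to discharge it.

No declaration in this file uses `sorry`; no named fact is introduced here.

## References

* M. Kervaire, J. Milnor, *Groups of homotopy spheres I*, Ann. of Math. (2) 77 (1963), 504–537:
  proof of Lemma 2.3 (pp. 506–507). doi:10.2307/1970128 [KervaireMilnorAnnals1963]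
* H. Miller, *Lectures on Algebraic Topology*, World Scientific (2020), Lemma 34.5, Cor. 37.4.
  [Miller2020]
* E. H. Spanier, *Algebraic Topology*, McGraw-Hill 1966 / Springer 1981, Ch. 6 §1 Ex. 7, §2
  Thm. 17. [Spanier1981]
* A. Hatcher, *Algebraic Topology*, CUP (2002), Thm. 2.16, Prop. 3.25, Thm. 3.26, Lemma 3.27.
  [HatcherAT2002]
-/

noncomputable section

open scoped Manifold ContDiff Topology ContinuousMap unitInterval
open CategoryTheory Limits Set Function
open Literature.AlgebraicTopology.SingularHomology Literature.AlgebraicTopology.Homotopy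

namespace Literature.Topology.FourManifolds

/-- Local notation: `𝔼 n` is the model Euclidean space `EuclideanSpace ℝ (Fin n)`. -/
local notation "𝔼 " n:arg => EuclideanSpace ℝ (Fin n)

namespace NullCobordism

variable {m : ℕ} {M : Type} [TopologicalSpace M] [ChartedSpace (𝔼 (m + 1)) M]
  [IsManifold (𝓡 (m + 1)) ∞ M] [CompactSpace M] [Nonempty M] (c₀ : NullCobordism (m + 1) M)

/-! ### The compact core of the interior has arbitrarily small contractible neighbourhoods -/

omit [IsManifold (𝓡 (m + 1)) ∞ M] in
/-- **Every open neighbourhood of the core `K = val⁻¹(W' ∖ κ(M × [0, t)))` (`t > 0`) in the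
interior `X` of a compact contractible `W'` contains a contractible open neighbourhood**: push the
neighbourhood to `W'` (`val` is an open embedding), find `W' ∖ κ(M × [0, s]) ⊆ val(U)` contractible
(`BoundaryCollar.exists_contractible_open_nhd_core`, `CollarSlab.lean`), and pull it back (it lies
in the interior, where `val` is a homeomorphism onto its image). This is the hypothesis of the
Alexander duality fact `isZero_localHomologyOfSet_of_contractible_nhds` at the compact set `K ⊆ X`.
[folklore] -/
theorem exists_contractible_nhd_coreInterior [ContractibleSpace c₀.W] {κ : BoundaryCollar c₀.W M}
    (hκ : ∀ x : M, κ.collar (x, 0) = c₀.incl x) {t : I} (ht : 0 < t) (U : Set c₀.Interior)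
    (hU : IsOpen U) (hKU : c₀.coreInterior κ t ⊆ U) :
    ∃ U' : Set c₀.Interior, IsOpen U' ∧ c₀.coreInterior κ t ⊆ U' ∧ U' ⊆ U ∧ ContractibleSpace ↥U' := by
  have hval : Topology.IsOpenEmbedding (InteriorManifold.val : c₀.Interior → c₀.W) :=
    InteriorManifold.isOpenEmbedding_val
  have hrange : range (InteriorManifold.val : c₀.Interior → c₀.W) = κ.interior := by
    rw [InteriorManifold.range_val, c₀.boundaryCollar_interior_eq hκ]
  -- `core t ⊆ val '' U`
  have hcore : κ.core t ⊆ InteriorManifold.val '' U := by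
    rw [← image_preimage_eq_of_subset (show κ.core t ⊆ range (InteriorManifold.val : c₀.Interior → _)
      from hrange.symm ▸ κ.core_subset_interior ht)]
    exact image_mono hKU
  obtain ⟨V, hVo, hKV, hVU, hVi, hV⟩ :=
    κ.exists_contractible_open_nhd_core ht (hval.isOpenMap U hU) hcore
  refine ⟨InteriorManifold.val ⁻¹' V, hVo.preimage InteriorManifold.continuous_val, fun v hv => hKV hv,
    fun v hv => ?_, ?_⟩
  · obtain ⟨v', hv', hvv'⟩ := hVU hv
    exact InteriorManifold.val_injective hvv' ▸ hv'
  · haveI := hV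
    -- `val ⁻¹' V ≃ₜ V`, as `V` lies in the interior `= range val`
    let e : ↥(InteriorManifold.val ⁻¹' V : Set c₀.Interior) ≃ₜ ↥V :=
      { toFun := fun v => ⟨v.1.val, v.2⟩
        invFun := fun w => ⟨c₀.ofInterior hκ w.1 (hVi w.2), w.2⟩
        left_inv := fun _ => rfl
        right_inv := fun _ => rfl
        continuous_toFun :=
          (InteriorManifold.continuous_val.comp continuous_subtype_val).subtype_mk _
        continuous_invFun :=
          (InteriorManifold.continuous_iff_comp_val.2 continuous_subtype_val).subtype_mk _ }
    exact e.contractibleSpace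

/-! ### Middle degrees: the boundary of a contractible manifold is acyclic below the top -/

/-- **The boundary of a compact contractible manifold is a homology sphere below the top
degree**, GIVEN the Alexander duality fact
`isZero_localHomologyOfSet_of_contractible_nhds ℤ` (Miller 2020, Cor. 37.4; Spanier 1966,
Thm. 6.2.17): for `M = ∂W'` closed of dimension `m + 1` and `W'` compact contractible,
`Hₖ(M; ℤ) = 0` for `1 ≤ k ≤ m`. Proof: with a collar `κ` of `∂W'` and the interior
`X = Int W'` (a simply connected, hence `ℤ`-oriented, acyclic boundaryless `(m+2)`-manifold,
`NullCobordismHCobordism.lean`), `M ≃ κ(M × (0, 1)) ≅ X ∖ K` for the compact core `K`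
(`BoundaryCollar.stripHomotopyEquiv`, `stripHomeomorphInterior`); `K` has arbitrarily small
contractible neighbourhoods in `X` (`exists_contractible_nhd_coreInterior`), so Alexander duality
gives `Hₖ₊₁(X | K; ℤ) = 0` for `k + 1 ≠ m + 2`, and the exact sequence
`Hₖ₊₁(X | K) → Hₖ(X ∖ K) → Hₖ(X) = 0` gives `Hₖ(M) ≅ Hₖ(X ∖ K) = 0` (Kervaire–Milnor 1963, proof
of Lemma 2.3, the Poincaré duality step, pp. 506–507).
[cite: KervaireMilnorAnnals1963, Lemma 2.3, proof (pp. 506–507)] -/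
theorem isZero_singularHomology_of_alexander [ContractibleSpace c₀.W]
    (hA : isZero_localHomologyOfSet_of_contractible_nhds ℤ) {k : ℕ} (hk : 1 ≤ k) (hkm : k ≤ m) :
    IsZero (singularHomology ℤ ℤ M k) := by
  obtain ⟨κ, hκ⟩ := c₀.exists_boundaryCollar
  haveI := c₀.simplyConnectedSpace_interior
  obtain ⟨μ⟩ : IsOrientableOver ℤ c₀.Interior (m + 1 + 1) :=
    isOrientableOver_of_simplyConnectedSpace ℤ c₀.Interior
  -- a level strictly between `0` and `1`
  let u : I := ⟨2⁻¹, by norm_num, by norm_num⟩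
  have hu : (0 : I) < u := show (0 : ℝ) < 2⁻¹ by norm_num
  have hu1 : u < 1 := show (2⁻¹ : ℝ) < 1 by norm_num
  -- `Hₖ(X ∖ K) = 0` by Alexander duality and the exact sequence of the pair
  have hX : IsZero (singularHomology ℤ ℤ ↥((c₀.coreInterior κ 1)ᶜ) k) :=
    isZero_singularHomology_compl_of_contractible_nhds ℤ hA μ (c₀.isCompact_coreInterior hκ zero_lt_one)
      (c₀.exists_contractible_nhd_coreInterior hκ zero_lt_one) (by omega)
      (c₀.isZero_singularHomology_interior (isZero_singularHomology_of_contractibleSpace ℤ ℤ (by omega)))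
  -- `M ≃ strip ≅ X ∖ K`
  exact hX.of_iso ((singularHomology.isoOfHomotopyEquiv ℤ ℤ (κ.stripHomotopyEquiv hu hu1) k) ≪≫
    singularHomology.mapIso ℤ ℤ (c₀.stripHomeomorphInterior hκ 1) k)

/-! ### Assembly -/

/-- **The Poincaré duality step of Kervaire–Milnor's Lemma 2.3 from Alexander duality.** The
named fact `NullCobordism.isIso_singularHomology_map_inclToComplCenter`
(`HomotopySpheresInverseHomotopy.lean`: for `M = ∂W'` closed simply connected of dimension
`n ≥ 2`, `W'` compact contractible and a disc `i : ℝⁿ⁺¹ → Int W'`, the map `M → W' ∖ {i 0}` is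
an isomorphism on all `Hₖ(-; ℤ)`; Kervaire–Milnor 1963, p. 507: "applying the Poincaré duality
isomorphism … the inclusion `M → W` also induces isomorphisms of homology groups") follows from
the single named fact `isZero_localHomologyOfSet_of_contractible_nhds ℤ` (Alexander duality at a
compact set with contractible neighbourhoods), everything else being proved: by
`isZero_singularHomology_of_alexander` (degrees `1 ≤ k ≤ n - 1`), Hatcher's Thm. 3.26(c)
(`isZero_singularHomology_of_lt_holds`, degrees `> n`) and Thm. 3.26(a) with Prop. 3.25
(`Hₙ(M; ℤ) ≅ ℤ`, `M` being simply connected hence `ℤ`-orientable), `M` is an integral homology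
`n`-sphere, and for such boundaries of acyclic simply connected `W'` the tree PROVES the
conclusion duality-free (`NullCobordism.isIso_map_inclToComplCenter`,
`NullCobordismHCobordism.lean`: the degree-`n` surjectivity `Hₙ(X ∖ K) → Hₙ(X ∖ {i 0})` by the
orientation class of the core, `AcyclicPuncture.lean`).
[cite: KervaireMilnorAnnals1963, Lemma 2.3, proof (pp. 506–507)] -/
theorem isIso_singularHomology_map_inclToComplCenter_of_alexander
    (hA : isZero_localHomologyOfSet_of_contractible_nhds ℤ) :
    NullCobordism.isIso_singularHomology_map_inclToComplCenter := by
  intro n M _ _ _ _ _ _ _ c hn hc D k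
  obtain ⟨m, rfl⟩ : ∃ m, n = m + 1 := ⟨n - 1, by omega⟩
  haveI := hc
  obtain ⟨μM⟩ : IsOrientableOver ℤ M (m + 1) := isOrientableOver_of_simplyConnectedSpace ℤ M
  refine c.isIso_map_inclToComplCenter D
    (fun k hk => isZero_singularHomology_of_contractibleSpace ℤ ℤ (by omega))
    (nonempty_singularHomology_top_iso_holds (R := ℤ) (X := M) (m + 1) μM) (fun k hk hkn => ?_) k
  rcases lt_or_gt_of_ne hkn with hlt | hgt
  · exact c.isZero_singularHomology_of_alexander hA hk (by omega)
  · exact isZero_singularHomology_of_lt_holds (R := ℤ) (M := ℤ) (X := M) (m + 1) hgt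

end NullCobordism

end Literature.Topology.FourManifolds
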